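import Literature.NumberTheory.Automorphic.AdeleQuotientFourierDecay
import HarnessLib

/-!
# Fourier coefficients on `𝔸_K ⧸ K` are bounded by the sup norm

Topic `NumberTheory/Automorphic`; namespace `Literature.NumberTheory.Automorphic`.  THEOREMS ONLY (no definition, no
instance, no notation, no named fact, no `sorry`).  Sequel of ★ `AdeleQuotientFourier` / ★ `AdeleQuotientFourierInversion` /
★ `AdeleQuotientFourierDecay` (characters `ψ_ξ = adeleQuotChar K ξ` of the compact group `𝔸_K ⧸ K`, Haar PROBABILITY measure `adeleQuotHaar K`,
orthogonality `integral_conj_adeleQuotChar_mul_tsum`, inversion `eq_tsum_integral_mul_adeleQuotChar`).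

THE (elementary) STATEMENT [CasselsFrohlichANT1967, Ch. XV §4.2 Lemma 4.2.2 and its proof; folklore]: since `𝔸_K ⧸ K`
carries a Haar PROBABILITY measure and `|ψ_ξ| = 1`, every Fourier coefficient of a bounded function is bounded by its
sup norm, `|f̂(ξ)| = |∫ conj ψ_ξ · f| ≤ sup |f|`; hence if a bounded function `g` on `𝔸_K ⧸ K` (or a bounded `K`-periodic
function `G` on `𝔸_K`) is the sum of an absolutely convergent Fourier series `Σ_ξ c_ξ ψ_ξ`, then EVERY coefficient obeys
`|c_η| ≤ sup |g|` — uniformly over any family `g_i` bounded by one constant.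

* (the coefficient bound itself, `‖∫ conj ψ_ξ(u) f(u) du‖ ≤ M` when `‖f‖ ≤ M`, is the tree's
  ★ `AdeleQuotientFourierDecay.norm_integral_conj_adeleQuotChar_mul_le` — reused, not restated);
* `norm_coeff_le_of_eq_tsum` — `‖c_η‖ ≤ M` when `g = Σ_ξ c_ξ ψ_ξ` (absolutely summable) and `‖g‖ ≤ M`; the family form
  `norm_coeff_le_of_eq_tsum_family`; the continuous-inversion form `norm_fourierCoeff_le_of_continuous`;
* `norm_coeff_le_of_periodic_eq_tsum` — the same for a `K`-periodic bounded `G : 𝔸_K → ℂ` expanded in the characters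
  `x ↦ ψ(ξ x)` of `𝔸_K` trivial on `K` (descent `periodicLift`), and its family form.

Cell `hodgecm-mathlib`, programme P4, ENGINE E-2 (H413), child line `F0_E2SiegelWeilWeilRange`, stub `stub_SW2_siegelWeil`,
identity road (W) [Weil1965, n° 50 Thm 4]: row I-COEFF — the Fourier extraction along `N(F)\N(𝔸) ≅ 𝔸_F ⧸ F` in Weil's
boundedness endgame: if `β ↦ E''(ω□(t(q_β)) Ξ)` is bounded by `M(Ξ)` and is the sum of its Fourier series with coefficients
`b ↦ μ''_b(Ξ)`, then `|μ''_b(Ξ)| ≤ M(Ξ)` for every `b ∈ F` (the I-STRUCT letters supply the expansion BY NAME).  HC_CM is proved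
only modulo the 7 printed citations until rung 0 closes — nothing here bears on a summit statement.

## References
* [CasselsFrohlichANT1967] J. Tate, *Fourier analysis in number fields and Hecke's zeta-functions*, in J. W. S. Cassels,
  A. Fröhlich (eds.), *Algebraic Number Theory* (1967), Ch. XV, §4.2, Lemma 4.2.2.
* [Weil1965] A. Weil, *Sur la formule de Siegel dans la théorie des groupes classiques*, Acta Math. 113 (1965) 1–87, n° 50
  Thm 4 (pp. 72–74): the Fourier coefficients of the bounded tempered measure `E'' = E′ − E` along `P_s`.
-/

noncomputable section

open _root_.MeasureTheory _root_.MeasureTheory.Measure Set Filter IsDedekindDomain NumberField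
open _root_.Topology
open scoped ENNReal ComplexConjugate

namespace Literature.NumberTheory.Automorphic

section CoeffBound

variable (K : Type) [Field K] [NumberField K]
  [MeasurableSpace (adeleQuotient K)] [BorelSpace (adeleQuotient K)]

/-- **Coefficients of an absolutely convergent Fourier series are bounded by the sup norm of its sum**: if
`g(u) = Σ_ξ c_ξ ψ_ξ(u)` with `Σ |c_ξ| < ∞` and `‖g(u)‖ ≤ M` for all `u`, then `‖c_η‖ ≤ M` for every `η ∈ K`
(`c_η = ∫ conj ψ_η · g`, ★ `integral_conj_adeleQuotChar_mul_tsum`; no continuity hypothesis).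
[cite: CasselsFrohlichANT1967, Ch. XV Lemma 4.2.2] -/
theorem norm_coeff_le_of_eq_tsum {g : adeleQuotient K → ℂ} {c : K → ℂ} (hc : Summable fun ξ => ‖c ξ‖)
    (hg : ∀ u, g u = ∑' ξ : K, c ξ * (adeleQuotChar K ξ u : ℂ)) {M : ℝ} (hM : ∀ u, ‖g u‖ ≤ M) (η : K) :
    ‖c η‖ ≤ M := by
  have hcoef : c η = ∫ u, conj (adeleQuotChar K η u : ℂ) * g u ∂(adeleQuotHaar K) := by
    have hfun : (fun u => conj (adeleQuotChar K η u : ℂ) * g u) =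
        fun u => conj (adeleQuotChar K η u : ℂ) * ∑' ξ : K, c ξ * (adeleQuotChar K ξ u : ℂ) :=
      funext fun u => by rw [hg u]
    rw [hfun, integral_conj_adeleQuotChar_mul_tsum K hc η]
  rw [hcoef]
  exact norm_integral_conj_adeleQuotChar_mul_le K hM η

/-- **Family form** (the shape Weil's boundedness endgame consumes): if every member of a family `g_i` of functions on
`𝔸_K ⧸ K` is the sum of an absolutely convergent Fourier series with coefficients `c_i`, and the family is UNIFORMLY bounded,
`‖g_i(u)‖ ≤ M`, then ALL coefficients satisfy `‖c_i(η)‖ ≤ M`. [cite: CasselsFrohlichANT1967, Ch. XV Lemma 4.2.2]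
[cite: Weil1965, n° 50 Thm 4 (pp. 72–74)] -/
theorem norm_coeff_le_of_eq_tsum_family {ι : Type*} {g : ι → adeleQuotient K → ℂ} {c : ι → K → ℂ}
    (hc : ∀ i, Summable fun ξ => ‖c i ξ‖) (hg : ∀ i u, g i u = ∑' ξ : K, c i ξ * (adeleQuotChar K ξ u : ℂ)) {M : ℝ}
    (hM : ∀ i u, ‖g i u‖ ≤ M) (i : ι) (η : K) : ‖c i η‖ ≤ M :=
  norm_coeff_le_of_eq_tsum K (hc i) (hg i) (hM i) η

/-- **Continuous-inversion form**: for `f` continuous on `𝔸_K ⧸ K` with absolutely summable Fourier coefficients (so that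
`f = Σ_ξ f̂(ξ) ψ_ξ`, ★ `eq_tsum_integral_mul_adeleQuotChar`) and `‖f‖ ≤ M`, every coefficient has `‖f̂(ξ)‖ ≤ M` — of course
already by ★ `norm_integral_conj_adeleQuotChar_mul_le`; recorded in the `tsum` currency for consumers quoting the expansion.
[cite: CasselsFrohlichANT1967, Ch. XV Lemma 4.2.2] -/
theorem norm_fourierCoeff_le_of_continuous {f : adeleQuotient K → ℂ} (hf : Continuous f)
    (hsum : Summable fun ξ : K => ‖∫ u, conj (adeleQuotChar K ξ u : ℂ) * f u ∂(adeleQuotHaar K)‖) {M : ℝ}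
    (hM : ∀ u, ‖f u‖ ≤ M) (η : K) :
    ‖∫ u, conj (adeleQuotChar K η u : ℂ) * f u ∂(adeleQuotHaar K)‖ ≤ M ∧
      f = fun v => ∑' ξ : K, (∫ u, conj (adeleQuotChar K ξ u : ℂ) * f u ∂(adeleQuotHaar K)) * (adeleQuotChar K ξ v : ℂ) :=
  ⟨norm_integral_conj_adeleQuotChar_mul_le K hM η, funext fun v => eq_tsum_integral_mul_adeleQuotChar K hf hsum v⟩

/-! ### The same for `K`-periodic functions on `𝔸_K` -/

/-- **Periodic form on `𝔸_K`**: a `K`-periodic function `G : 𝔸_K → ℂ` with `‖G‖ ≤ M` which is the sum of an absolutely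
convergent series `G(x) = Σ_ξ c_ξ ψ(ξ x)` in Tate's character `ψ = adeleAddChar K` (trivial on `K`) has all its coefficients
bounded: `‖c_η‖ ≤ M` (descend to `𝔸_K ⧸ K` by `periodicLift`). [cite: CasselsFrohlichANT1967, Ch. XV Lemma 4.2.2]
[cite: Weil1965, n° 50 Thm 4 (pp. 72–74)] -/
theorem norm_coeff_le_of_periodic_eq_tsum {G : AdeleRing (𝓞 K) K → ℂ}
    (hper : ∀ (k : K) (x : AdeleRing (𝓞 K) K), G (algebraMap K (AdeleRing (𝓞 K) K) k + x) = G x)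
    {c : K → ℂ} (hc : Summable fun ξ => ‖c ξ‖)
    (hG : ∀ x, G x = ∑' ξ : K, c ξ * (adeleAddChar K (algebraMap K (AdeleRing (𝓞 K) K) ξ * x) : ℂ))
    {M : ℝ} (hM : ∀ x, ‖G x‖ ≤ M) (η : K) : ‖c η‖ ≤ M := by
  refine norm_coeff_le_of_eq_tsum K (g := periodicLift G hper) hc (fun u => ?_) (fun u => ?_) η
  · induction u using QuotientAddGroup.induction_on with
    | H x =>
      rw [periodicLift_mk, hG x]
      exact tsum_congr fun ξ => by rw [adeleQuotChar_mk]
  · induction u using QuotientAddGroup.induction_on with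
    | H x => rw [periodicLift_mk]; exact hM x

/-- **Periodic family form**: `K`-periodic functions `G_i : 𝔸_K → ℂ`, uniformly bounded by `M`, each the sum of an absolutely
convergent series `Σ_ξ c_i(ξ) ψ(ξ x)`: all coefficients satisfy `‖c_i(η)‖ ≤ M` — in Weil's endgame `i` ranges over the
dilations `t` (and test data), `x = β`, `c_i(b) = μ''_b(t(q_β) d_v(t) Ψ)` and `M = M(Ψ)`.
[cite: Weil1965, n° 50 Thm 4 (pp. 72–74)] [cite: CasselsFrohlichANT1967, Ch. XV Lemma 4.2.2] -/
theorem norm_coeff_le_of_periodic_eq_tsum_family {ι : Type*} {G : ι → AdeleRing (𝓞 K) K → ℂ}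
    (hper : ∀ i (k : K) (x : AdeleRing (𝓞 K) K), G i (algebraMap K (AdeleRing (𝓞 K) K) k + x) = G i x)
    {c : ι → K → ℂ} (hc : ∀ i, Summable fun ξ => ‖c i ξ‖)
    (hG : ∀ i x, G i x = ∑' ξ : K, c i ξ * (adeleAddChar K (algebraMap K (AdeleRing (𝓞 K) K) ξ * x) : ℂ))
    {M : ℝ} (hM : ∀ i x, ‖G i x‖ ≤ M) (i : ι) (η : K) : ‖c i η‖ ≤ M :=
  norm_coeff_le_of_periodic_eq_tsum K (hper i) (hc i) (hG i) (hM i) η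

/-- **Sup form**: with `M := ⨆_u ‖g u‖` (a bounded function on the compact quotient), `‖c_η‖ ≤ ⨆_u ‖g u‖`.
[cite: CasselsFrohlichANT1967, Ch. XV Lemma 4.2.2] -/
theorem norm_coeff_le_ciSup_of_eq_tsum {g : adeleQuotient K → ℂ} {c : K → ℂ} (hc : Summable fun ξ => ‖c ξ‖)
    (hg : ∀ u, g u = ∑' ξ : K, c ξ * (adeleQuotChar K ξ u : ℂ)) (hbdd : BddAbove (Set.range fun u => ‖g u‖)) (η : K) :
    ‖c η‖ ≤ ⨆ u, ‖g u‖ :=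
  norm_coeff_le_of_eq_tsum K hc hg (fun u => le_ciSup hbdd u) η

end CoeffBound

end Literature.NumberTheory.Automorphic

end
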